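import Summits.BirchSwinnertonDyer.BirchSwinnertonDyer.Theorems.UniversalToricDescentTwinSplitIMCAtThreeGoodOrdIntegral
import HarnessLib

/-!
# Route `UniversalToricDescent`, crux #3 `TwinSplitIMCAtThree` (item stmt-BirchSwinnertonDyer-20214) AT ANY
# TWIN: clause (ii) at EVERY frame is EXACTLY three `∃`-frame statements — a HOWARD frame (`L ∈ I`), a
# rational WAN frame (`p^k · I ⊆ (L)`), a `μ = 0` frame — by integral cross-period rigidity and prime
# avoidance; and the `⊇`-half at every frame is exactly ONE Howard frame. Bucket-free (good ordinary, good
# supersingular, multiplicative alike); buckets C (603) and B (675) read through it.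

Seat `bsd-wall-utd-p2` g2 (D-0131 (3) MIDDLE tier, strategy «twin-split IMC at 3, ⊇-half only: Howard 2004
/ BCK21 transfer pushed to `p = 3` on the 2 023 twin classes (TWIN-PRINT-AT3 v1 §1 gap list as the work
order)»). g0 closed row 1 of that gap list (good-ordinary twins, bucket A = 745 classes) by name of three
refereed facts (`twinSplit_instance_of_goodOrd`, p540959). Rows 2–4 (multiplicative twins = bucket B, 675;
good-supersingular twins = bucket C, 603) have NO refereed print at `p = 3` for either half. This file
isolates, in the kernel and in the crux's own currency, WHAT a proof of those rows must supply — nothing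
number-theoretic is assumed; every theorem here is unconditional algebra over `R₀⟦T⟧` plus the tree's
integral cross-period rigidity (`span_singleton_eq_of_isBDPLFunction`, p536114, any prime).

§1 (any prime `p`, an ABSTRACT ideal `I ⊆ R₀⟦T⟧`, frames of one `(ι, 𝔭, κ, γ, f)` with `K` imaginary
quadratic, `κ` anticyclotomic, `γ` a topological generator):
* `span_le_forall_frame_of_exists_mem` — ONE frame with `L ∈ I` ⟹ EVERY frame has `(L′) ⊆ I`
  (the `⊇`-half of clause (ii) at every frame costs exactly one Howard-direction frame).
* `eq_span_forall_frame_of_three_frames` — a Howard frame (`L₁ ∈ I`), a rational Wan frame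
  (`∃ k, p^k · I ⊆ (L₂)`), and a `μ = 0` frame (`∃ i, coeff_i L₃ ∈ R₀ˣ`), at three a-priori unrelated
  period pairs, ⟹ `I = (L′)` for EVERY frame `L′`. (Rigidity moves the first two statements to the third
  frame; `μ(L₃) = 0 ⟹ p ∤ L₃` (`not_C_dvd_of_isUnit_coeff`); prime avoidance by the prime `p ∈ R₀⟦T⟧`
  (`stub_E3`, route BED, reused) gives `I ⊆ (L₃)`; `forall_frame_eq_span_of_exists` spreads the identity.)
* `eq_span_forall_frame_of_two_frames` — the same with an INTEGRAL Wan frame (`I ⊆ (L₂)`), no `μ` needed.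

§2 (`p = 3`, the crux's literal currency `I = Ch_Λ(X_ac(W′_K) strict at 𝔭′)·R₀⟦T⟧` along `toUnr 3`, ANY
twin `W′` — no reduction-type, image or discriminant hypothesis enters the algebra):
* `crux_conjunct_one_and_supset_forall_frame_of_howardFrame` — a Howard frame ⟹ conjunct (i) verbatim
  and the `⊇`-half of (ii) at EVERY frame.
* `twinSplit_instance_of_three_frames` — Howard frame + rational Wan frame + `μ = 0` frame ⟹ conjuncts
  (i) ∧ (ii) of `TwinSplitIMCAtThree` VERBATIM at `(W′, N′, K, Dt′, κ, γ, 𝔭, 𝔭′, ι′)`.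
* `twinSplit_instance_of_howardFrame_of_wanFrame_of_good` — for a twin of GOOD reduction at `3` (ordinary
  OR supersingular) with `ρ̄₃` onto over `ℚ`, `K` Heegner for `N′` with `3` split and `D_K` odd, the
  `μ = 0` frame is PRINT by name (`h422` = BCS 2025 Prop. 4.2.2 = Hsieh 2014 Thm. B, good reduction at
  `p > 2`, no ordinarity): crux #3 at such a twin ⟸ ONE Howard frame ∧ ONE rational Wan frame.

PARTITION currency (census TWIN-PRINT-AT3-v1 §2; 2 023 twin-having classes of leaf
`WAllExclAddWildRankOneSurjTwin`). Bucket A (745, good-ordinary twin): both frames are refereed print by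
name (BCS25 4.2.1 (b); Yan–Zhu 2026 5.7 (1)) — p540959, unchanged. **Bucket C (603, good-supersingular twins
only): crux #3 ⟸ HOWARD-FRAME(ss) ∧ WAN-FRAME(ss) modulo the refereed `h422`** — print status at `p = 3`,
first-hand: HOWARD-FRAME(ss) = Castella–Çiperiani–Skinner–Sprung arXiv:1804.10993v2 Thm. 5.7 + Lemma 5.5
(⟹ `𝔛^{rel,str}` `Λ`-torsion and `length_𝔓(𝔛^{rel,str}) ≤ 2·ord_𝔓(𝓛_𝔭^BDP)` at every height-one `𝔓`,
first display of the proof of Thm. 5.8, `[corpus: paper:arxiv-1804.10993 p0022 L79–L97, p0021 L109–L137,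
p0023 L2–L17]`; standing §4: "`p > 2` a prime of good non-ordinary reduction", `p = 𝔭𝔭̄` split, `N⁻`
square-free with `N⁻ = 1` ALLOWED ("with the cusps added if `N⁻ = 1`", p0016 L26), `ρ̄_f|_{G_K}`
irreducible; covers `a_3 = 0` AND `a_3 = ±3` via `♯/♭`) — a PREPRINT since 2018 (the tree's
`CastellaCiperianiSkinnerSprung2018/NonordinaryPPartOPEN.lean` records its Thms. C/D as OPEN claims), and
Castella–Wan, Math. Ann. 389 (2024) §5 (refereed, standing `p ≥ 5`): NOT refereed print at `p = 3`.
WAN-FRAME(ss) under the crux's CLASSICAL Heegner hypothesis (`N⁻ = 1`): Burungale–Büyükboduk–Lei II /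
Kobayashi–Ota at `p ≥ 5` only; CÇSS18 Thm. 5.1 / CW24 Thm. 5.3 need a non-split prime of `N` — NOT in
print at `p = 3`, not even as a preprint. **Bucket B (675, `3 ∥ N′` twins only): crux #3 ⟸ the three
frames, NONE in print at `p = 3`** (Castella 2018 Thm. A / §§2–4: `p ≥ 5`, and its `⊆` goes through a
JSW-type field with a non-split prime). Beyond-print BSD theorem: NO. `--supports stmt-BirchSwinnertonDyer-20214`.

References: [Castella2018] Thm. 3.1 (the frame predicate); [BurungaleCastellaSkinner2025] Prop. 4.2.2;
[Hsieh2014] Thm. B; [CastellaCiperianiSkinnerSprung2018] Thm. 5.7, Lemma 5.5, Thm. 5.8 (arXiv:1804.10993v2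
§5.1); [CastellaWan2024PerrinRiou] §5; [Washington1997] §7 (Weierstrass preparation behind the rigidity).
-/

noncomputable section

open scoped Classical Topology

set_option linter.dupNamespace false
set_option autoImplicit false

namespace Summit.BirchSwinnertonDyer.BirchSwinnertonDyer.Theorems.UniversalToricDescentTwinSplit

open Filter PowerSeries WeierstrassCurve NumberField IsDedekindDomain Field
  Literature.NumberTheory.EllipticCurves
  Literature.NumberTheory.EllipticCurves.ModularForms
  Literature.NumberTheory.EllipticCurves.Rank1Residual
  Literature.NumberTheory.GaloisRepresentations
  Summit.BirchSwinnertonDyer.Rank1Residual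
  Summit.BirchSwinnertonDyer.Rank1Residual.X11b
  Summit.BirchSwinnertonDyer.Rank1Residual.X11b.Halves
  Summit.BirchSwinnertonDyer.BirchSwinnertonDyer.Theorems.SchneiderFree
  Summit.BirchSwinnertonDyer.Rank1Residual.X2.HidaLimitAlgebra

/-! ## §1 Any prime, abstract ideal: one / two / three frames -/

section AnyPrime

variable {p : ℕ} [hp : Fact p.Prime] {K : Type} [Field K] [NumberField K] {N : ℕ}
  {ι : PadicAlgCl p ≃+* ℂ} {𝔭 : HeightOneSpectrum (𝓞 K)} {κ : ZpExtension K p}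
  {γ : Field.absoluteGaloisGroup K} {f : CuspForm (CongruenceSubgroup.Gamma0 N) 2}

/-- **One Howard frame gives the `⊇`-half at every frame.** If SOME frame `(Ω_K ≠ 0, Ω_p ≠ 0, L)` of
`(ι, 𝔭, κ, γ, f)` has `L ∈ I`, then EVERY frame `L′` has `(L′) ⊆ I` (`K` imaginary quadratic, `κ`
anticyclotomic, `γ` a topological generator; any prime `p`, any ideal `I` of `R₀⟦T⟧`).
[cite: Castella2018, Thm. 3.1 (arXiv:1704.06608 p. 9) (the frame predicate)] -/
theorem span_le_forall_frame_of_exists_mem (hK : IsImaginaryQuadratic K) (hκ : κ.IsAnticyclotomic)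
    (hγ : κ.IsTopGenerator γ) {I : Ideal (UnrSeries p)}
    (h₁ : ∃ (ΩK : ℂ) (Ωp : ℂ_[p]) (L : UnrSeries p), ΩK ≠ 0 ∧ Ωp ≠ 0 ∧
      IsBDPLFunction ι 𝔭 κ γ f ΩK Ωp L ∧ L ∈ I) :
    ∀ (ΩK' : ℂ) (Ωp' : ℂ_[p]) (L' : UnrSeries p), ΩK' ≠ 0 → Ωp' ≠ 0 →
      IsBDPLFunction ι 𝔭 κ γ f ΩK' Ωp' L' → Ideal.span {L'} ≤ I := by
  intro ΩK' Ωp' L' hΩK' hΩp' hL'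
  obtain ⟨ΩK, Ωp, L, hΩK, hΩp, hL, hmem⟩ := h₁
  rw [Ideal.span_singleton_le_iff_mem]
  exact mem_of_frame_of_frame hK hκ hγ hΩK hΩK' hΩp hΩp' hL hL' hmem

/-- **Two frames (Howard + INTEGRAL Wan) give the identity at every frame.** If some frame has `L₁ ∈ I`
and some (other) frame has `I ⊆ (L₂)`, then `I = (L′)` for EVERY frame `L′`.
[cite: Castella2018, Thm. 3.1 (arXiv:1704.06608 p. 9) (the frame predicate)] -/
theorem eq_span_forall_frame_of_two_frames (hK : IsImaginaryQuadratic K) (hκ : κ.IsAnticyclotomic)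
    (hγ : κ.IsTopGenerator γ) {I : Ideal (UnrSeries p)}
    (h₁ : ∃ (ΩK : ℂ) (Ωp : ℂ_[p]) (L : UnrSeries p), ΩK ≠ 0 ∧ Ωp ≠ 0 ∧
      IsBDPLFunction ι 𝔭 κ γ f ΩK Ωp L ∧ L ∈ I)
    (h₂ : ∃ (ΩK : ℂ) (Ωp : ℂ_[p]) (L : UnrSeries p), ΩK ≠ 0 ∧ Ωp ≠ 0 ∧
      IsBDPLFunction ι 𝔭 κ γ f ΩK Ωp L ∧ I ≤ Ideal.span {L}) :
    ∀ (ΩK' : ℂ) (Ωp' : ℂ_[p]) (L' : UnrSeries p), ΩK' ≠ 0 → Ωp' ≠ 0 →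
      IsBDPLFunction ι 𝔭 κ γ f ΩK' Ωp' L' → I = Ideal.span {L'} := by
  obtain ⟨ΩK₂, Ωp₂, L₂, hΩK₂, hΩp₂, hL₂, hle₂⟩ := h₂
  have hge₂ : Ideal.span {L₂} ≤ I :=
    span_le_forall_frame_of_exists_mem hK hκ hγ h₁ ΩK₂ Ωp₂ L₂ hΩK₂ hΩp₂ hL₂
  exact forall_frame_eq_span_of_exists hK hκ hγ
    ⟨ΩK₂, Ωp₂, L₂, hΩK₂, hΩp₂, hL₂, le_antisymm hle₂ hge₂⟩

/-- **Three frames (Howard + RATIONAL Wan + `μ = 0`) give the identity at every frame.** If some frame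
has `L₁ ∈ I`, some frame has `p^k · I ⊆ (L₂)` for some `k`, and some frame `L₃` has a unit coefficient
(`μ(L₃) = 0`), then `I = (L′)` for EVERY frame `L′`: at the third frame `(L₃) ⊆ I` and `p^k · I ⊆ (L₃)`
by rigidity, `p ∤ L₃` by `μ = 0`, so prime avoidance by the prime element `p` of `R₀⟦T⟧` gives
`I ⊆ (L₃)`. Any prime `p`, any ideal `I`. [cite: Castella2018, Thm. 3.1 (arXiv:1704.06608 p. 9) (the frame predicate)]
[cite: Washington1997, §7.1–7.2 (Weierstrass preparation behind the rigidity and the prime `p` of `R₀⟦T⟧`)] -/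
theorem eq_span_forall_frame_of_three_frames (hK : IsImaginaryQuadratic K) (hκ : κ.IsAnticyclotomic)
    (hγ : κ.IsTopGenerator γ) {I : Ideal (UnrSeries p)}
    (h₁ : ∃ (ΩK : ℂ) (Ωp : ℂ_[p]) (L : UnrSeries p), ΩK ≠ 0 ∧ Ωp ≠ 0 ∧
      IsBDPLFunction ι 𝔭 κ γ f ΩK Ωp L ∧ L ∈ I)
    (h₂ : ∃ (ΩK : ℂ) (Ωp : ℂ_[p]) (L : UnrSeries p), ΩK ≠ 0 ∧ Ωp ≠ 0 ∧
      IsBDPLFunction ι 𝔭 κ γ f ΩK Ωp L ∧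
      ∃ k : ℕ, ∀ G ∈ I, PowerSeries.C (((p : ℕ) : unrIntegers p) ^ k) * G ∈ Ideal.span {L})
    (h₃ : ∃ (ΩK : ℂ) (Ωp : ℂ_[p]) (L : UnrSeries p), ΩK ≠ 0 ∧ Ωp ≠ 0 ∧
      IsBDPLFunction ι 𝔭 κ γ f ΩK Ωp L ∧ ∃ i : ℕ, IsUnit (PowerSeries.coeff i L)) :
    ∀ (ΩK' : ℂ) (Ωp' : ℂ_[p]) (L' : UnrSeries p), ΩK' ≠ 0 → Ωp' ≠ 0 →
      IsBDPLFunction ι 𝔭 κ γ f ΩK' Ωp' L' → I = Ideal.span {L'} := by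
  obtain ⟨ΩK₂, Ωp₂, L₂, hΩK₂, hΩp₂, hL₂, k, hk⟩ := h₂
  obtain ⟨ΩK₃, Ωp₃, L₃, hΩK₃, hΩp₃, hL₃, hμ⟩ := h₃
  -- `⊇` at the third frame
  have hge₃ : Ideal.span {L₃} ≤ I :=
    span_le_forall_frame_of_exists_mem hK hκ hγ h₁ ΩK₃ Ωp₃ L₃ hΩK₃ hΩp₃ hL₃
  -- `(L₂) = (L₃)`, so the rational `⊆` holds at the third frame
  have h23 : Ideal.span ({L₃} : Set (UnrSeries p)) = Ideal.span {L₂} :=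
    span_singleton_eq_of_isBDPLFunction hK hκ hγ hΩK₂ hΩK₃ hΩp₂ hΩp₃ hL₂ hL₃
  have hk₃ : ∀ G ∈ I, PowerSeries.C (((p : ℕ) : unrIntegers p) ^ k) * G ∈ Ideal.span {L₃} := by
    intro G hG
    rw [h23]
    exact hk G hG
  -- `μ(L₃) = 0 ⟹ p ∤ L₃`, prime avoidance
  have hndvd : ¬ (C ((p : ℕ) : unrIntegers p) : UnrSeries p) ∣ L₃ := not_C_dvd_of_isUnit_coeff hμ
  have hle₃ : I ≤ Ideal.span {L₃} :=
    BiquadraticEisensteinDescentEisensteinDivisibilityCMInertBadStubE3.stub_E3 p I L₃ k hndvd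
      (fun G hG ↦ by rw [← map_pow]; exact hk₃ G hG)
  exact forall_frame_eq_span_of_exists hK hκ hγ
    ⟨ΩK₃, Ωp₃, L₃, hΩK₃, hΩp₃, hL₃, le_antisymm hle₃ hge₃⟩

end AnyPrime

/-! ## §2 `p = 3`, the crux's literal currency, ANY twin -/

section Crux

variable (W' : WeierstrassCurve ℚ) (N' : ℕ) [NeZero N']
  (K : Type) [Field K] [NumberField K] (Dt' : ModularParametrizationData W' N')
  (κ : ZpExtension K 3) (γ : absoluteGaloisGroup K)
  (𝔭 𝔭' : HeightOneSpectrum (𝓞 K)) (ι' : PadicAlgCl 3 ≃+* ℂ)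

/-- **`⊇` at every frame from ONE Howard frame, any twin.** For ANY `W′/ℚ` with parametrisation datum
`Dt′` (no reduction-type, image or discriminant hypothesis), `K` imaginary quadratic, `κ` anticyclotomic
with topological generator `γ`, and any `𝔭, 𝔭′, ι′`: if SOME frame `(Ω_K ≠ 0, Ω_p ≠ 0, L)` of `f_{W′}` at
`(ι′, 𝔭)` has `L ∈ Ch_Λ(X_ac(W′_K) strict at 𝔭′)·R₀⟦T⟧` (a HOWARD-DIRECTION frame), then conjunct (i) of
crux #3 holds verbatim and the `⊇`-half of (ii) holds at EVERY frame. This is the whole content of the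
seat's «⊇-half only» at a twin: one frame in the Howard direction.
[cite: Castella2018, Thm. 3.1 (arXiv:1704.06608 p. 9) (the frame predicate)] -/
theorem crux_conjunct_one_and_supset_forall_frame_of_howardFrame
    (hK : IsImaginaryQuadratic K) (hκ : κ.IsAnticyclotomic) [hγ : Fact (κ.IsTopGenerator γ)]
    (hHow : ∃ (ΩK : ℂ) (Ωp : ℂ_[3]) (L : UnrSeries 3), ΩK ≠ 0 ∧ Ωp ≠ 0 ∧
      IsBDPLFunction ι' 𝔭 κ γ Dt'.f ΩK Ωp L ∧
      L ∈ (AcSelmer.XAc.charIdeal (W'.baseChange K) 3 κ 𝔭' ∅ γ).map (PowerSeries.map (toUnr 3))) :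
    (∃ (ΩK : ℂ) (Ωp : ℂ_[3]) (L' : UnrSeries 3), ΩK ≠ 0 ∧ Ωp ≠ 0 ∧
        IsBDPLFunction ι' 𝔭 κ γ Dt'.f ΩK Ωp L') ∧
      (∀ (ΩK : ℂ) (Ωp : ℂ_[3]) (L' : UnrSeries 3), ΩK ≠ 0 → Ωp ≠ 0 →
        IsBDPLFunction ι' 𝔭 κ γ Dt'.f ΩK Ωp L' →
        Ideal.span {L'} ≤
          (AcSelmer.XAc.charIdeal (W'.baseChange K) 3 κ 𝔭' ∅ γ).map (PowerSeries.map (toUnr 3))) := by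
  refine ⟨?_, span_le_forall_frame_of_exists_mem hK hκ hγ.out hHow⟩
  obtain ⟨ΩK, Ωp, L, hΩK, hΩp, hL, -⟩ := hHow
  exact ⟨ΩK, Ωp, L, hΩK, hΩp, hL⟩

/-- **Crux #3 at ANY twin from three frames.** For ANY `W′/ℚ` with datum `Dt′`, `K` imaginary quadratic,
`κ` anticyclotomic with topological generator `γ`, any `𝔭, 𝔭′, ι′`, with
`I := Ch_Λ(X_ac(W′_K) strict at 𝔭′)·R₀⟦T⟧`: a HOWARD frame (`L₁ ∈ I`), a rational WAN frame
(`∃ k, 3^k · I ⊆ (L₂)`) and a `μ = 0` frame (`L₃` with a unit coefficient) of `f_{W′}` at `(ι′, 𝔭)` give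
conjuncts (i) ∧ (ii) of `TwinSplitIMCAtThree` VERBATIM at `(W′, N′, K, Dt′, κ, γ, 𝔭, 𝔭′, ι′)`. Bucket-free;
nothing number-theoretic assumed. [cite: Castella2018, Thm. 3.1 (arXiv:1704.06608 p. 9) (the frame predicate)] -/
theorem twinSplit_instance_of_three_frames
    (hK : IsImaginaryQuadratic K) (hκ : κ.IsAnticyclotomic) [hγ : Fact (κ.IsTopGenerator γ)]
    (hHow : ∃ (ΩK : ℂ) (Ωp : ℂ_[3]) (L : UnrSeries 3), ΩK ≠ 0 ∧ Ωp ≠ 0 ∧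
      IsBDPLFunction ι' 𝔭 κ γ Dt'.f ΩK Ωp L ∧
      L ∈ (AcSelmer.XAc.charIdeal (W'.baseChange K) 3 κ 𝔭' ∅ γ).map (PowerSeries.map (toUnr 3)))
    (hWan : ∃ (ΩK : ℂ) (Ωp : ℂ_[3]) (L : UnrSeries 3), ΩK ≠ 0 ∧ Ωp ≠ 0 ∧
      IsBDPLFunction ι' 𝔭 κ γ Dt'.f ΩK Ωp L ∧
      ∃ k : ℕ, ∀ G ∈ (AcSelmer.XAc.charIdeal (W'.baseChange K) 3 κ 𝔭' ∅ γ).map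
        (PowerSeries.map (toUnr 3)), PowerSeries.C (((3 : ℕ) : unrIntegers 3) ^ k) * G ∈ Ideal.span {L})
    (hMu : ∃ (ΩK : ℂ) (Ωp : ℂ_[3]) (L : UnrSeries 3), ΩK ≠ 0 ∧ Ωp ≠ 0 ∧
      IsBDPLFunction ι' 𝔭 κ γ Dt'.f ΩK Ωp L ∧ ∃ i : ℕ, IsUnit (PowerSeries.coeff i L)) :
    (∃ (ΩK : ℂ) (Ωp : ℂ_[3]) (L' : UnrSeries 3), ΩK ≠ 0 ∧ Ωp ≠ 0 ∧
        IsBDPLFunction ι' 𝔭 κ γ Dt'.f ΩK Ωp L') ∧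
      (∀ (ΩK : ℂ) (Ωp : ℂ_[3]) (L' : UnrSeries 3), ΩK ≠ 0 → Ωp ≠ 0 →
        IsBDPLFunction ι' 𝔭 κ γ Dt'.f ΩK Ωp L' →
        (AcSelmer.XAc.charIdeal (W'.baseChange K) 3 κ 𝔭' ∅ γ).map (PowerSeries.map (toUnr 3)) =
          Ideal.span {L'}) := by
  refine ⟨?_, eq_span_forall_frame_of_three_frames hK hκ hγ.out hHow hWan hMu⟩
  obtain ⟨ΩK, Ωp, L, hΩK, hΩp, hL, -⟩ := hMu
  exact ⟨ΩK, Ωp, L, hΩK, hΩp, hL⟩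

/-- **Crux #3 at ANY twin from two frames (Howard + INTEGRAL Wan).** As `twinSplit_instance_of_three_frames`,
with an integral Wan frame (`I ⊆ (L₂)`) and no `μ = 0` frame.
[cite: Castella2018, Thm. 3.1 (arXiv:1704.06608 p. 9) (the frame predicate)] -/
theorem twinSplit_instance_of_two_frames
    (hK : IsImaginaryQuadratic K) (hκ : κ.IsAnticyclotomic) [hγ : Fact (κ.IsTopGenerator γ)]
    (hHow : ∃ (ΩK : ℂ) (Ωp : ℂ_[3]) (L : UnrSeries 3), ΩK ≠ 0 ∧ Ωp ≠ 0 ∧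
      IsBDPLFunction ι' 𝔭 κ γ Dt'.f ΩK Ωp L ∧
      L ∈ (AcSelmer.XAc.charIdeal (W'.baseChange K) 3 κ 𝔭' ∅ γ).map (PowerSeries.map (toUnr 3)))
    (hWan : ∃ (ΩK : ℂ) (Ωp : ℂ_[3]) (L : UnrSeries 3), ΩK ≠ 0 ∧ Ωp ≠ 0 ∧
      IsBDPLFunction ι' 𝔭 κ γ Dt'.f ΩK Ωp L ∧
      (AcSelmer.XAc.charIdeal (W'.baseChange K) 3 κ 𝔭' ∅ γ).map (PowerSeries.map (toUnr 3)) ≤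
        Ideal.span {L}) :
    (∃ (ΩK : ℂ) (Ωp : ℂ_[3]) (L' : UnrSeries 3), ΩK ≠ 0 ∧ Ωp ≠ 0 ∧
        IsBDPLFunction ι' 𝔭 κ γ Dt'.f ΩK Ωp L') ∧
      (∀ (ΩK : ℂ) (Ωp : ℂ_[3]) (L' : UnrSeries 3), ΩK ≠ 0 → Ωp ≠ 0 →
        IsBDPLFunction ι' 𝔭 κ γ Dt'.f ΩK Ωp L' →
        (AcSelmer.XAc.charIdeal (W'.baseChange K) 3 κ 𝔭' ∅ γ).map (PowerSeries.map (toUnr 3)) =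
          Ideal.span {L'}) := by
  refine ⟨?_, eq_span_forall_frame_of_two_frames hK hκ hγ.out hHow hWan⟩
  obtain ⟨ΩK, Ωp, L, hΩK, hΩp, hL, -⟩ := hHow
  exact ⟨ΩK, Ωp, L, hΩK, hΩp, hL⟩

/-- **Crux #3 at a twin of GOOD reduction at `3` (ordinary OR supersingular — buckets A and C) from two
frames, the `μ = 0` frame being PRINT by name.** `W′` globally minimal, GOOD at `3`, `ρ̄_{W′,3}` onto over
`ℚ`; `K` imaginary quadratic with the Heegner hypothesis for `N′` and `D_K` odd; `κ` anticyclotomic with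
topological generator `γ`; `𝔭 ∋ 3` of degree one (so `3` splits and `D_K ≠ −3`), `𝔭′ ∋ 3`, `𝔭′ ≠ 𝔭`; `ι′`
inducing `𝔭`. A HOWARD frame and a rational WAN frame of `f_{W′}` at `(ι′, 𝔭)` give (i) ∧ (ii) of
`TwinSplitIMCAtThree` VERBATIM; the third frame is `h422` (BCS 2025 Prop. 4.2.2 = Hsieh 2014 Thm. B: good
reduction at `p > 2`, no ordinarity; `exists_frame_mu_eq_zero_of_good`, p539728). On bucket C (603 classes,
good-supersingular twins only) this is the whole reduction of crux #3 to its two research inputs at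
`p = 3`; on bucket A both inputs are refereed print (p540959). CONDITIONAL on `h422`.
[cite: BurungaleCastellaSkinner2025, Prop. 4.2.2 and its proof (§4.2, pp. 8–9 of arXiv:2405.00270v2)]
[cite: Hsieh2014, Thm. B (the source of `μ = 0`)] -/
theorem twinSplit_instance_of_howardFrame_of_wanFrame_of_good [W'.IsElliptic] [W'.IsGloballyMinimal]
    (h422 : BurungaleCastellaSkinner2025.prop422_exists_isBDPLFunction_mu_eq_zero)
    (hgood : W'.HasGoodReductionAtPrime 3) (hsurj : W'.HasSurjectiveModNGaloisRep 3)
    (hK : IsImaginaryQuadratic K) (hH : SatisfiesHeegnerHypothesis N' K)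
    (hodd : Odd (NumberField.discr K)) (hκ : κ.IsAnticyclotomic) [hγ : Fact (κ.IsTopGenerator γ)]
    (h𝔭 : ((3 : ℕ) : 𝓞 K) ∈ 𝔭.asIdeal)
    (he : 𝔭.asIdeal.ramificationIdx (𝓞 ℚ) = 1) (hf : 𝔭.asIdeal.inertiaDeg (𝓞 ℚ) = 1)
    (hι' : BranchInducesPrime 3 ι' 𝔭)
    (hHow : ∃ (ΩK : ℂ) (Ωp : ℂ_[3]) (L : UnrSeries 3), ΩK ≠ 0 ∧ Ωp ≠ 0 ∧
      IsBDPLFunction ι' 𝔭 κ γ Dt'.f ΩK Ωp L ∧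
      L ∈ (AcSelmer.XAc.charIdeal (W'.baseChange K) 3 κ 𝔭' ∅ γ).map (PowerSeries.map (toUnr 3)))
    (hWan : ∃ (ΩK : ℂ) (Ωp : ℂ_[3]) (L : UnrSeries 3), ΩK ≠ 0 ∧ Ωp ≠ 0 ∧
      IsBDPLFunction ι' 𝔭 κ γ Dt'.f ΩK Ωp L ∧
      ∃ k : ℕ, ∀ G ∈ (AcSelmer.XAc.charIdeal (W'.baseChange K) 3 κ 𝔭' ∅ γ).map
        (PowerSeries.map (toUnr 3)), PowerSeries.C (((3 : ℕ) : unrIntegers 3) ^ k) * G ∈ Ideal.span {L}) :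
    (∃ (ΩK : ℂ) (Ωp : ℂ_[3]) (L' : UnrSeries 3), ΩK ≠ 0 ∧ Ωp ≠ 0 ∧
        IsBDPLFunction ι' 𝔭 κ γ Dt'.f ΩK Ωp L') ∧
      (∀ (ΩK : ℂ) (Ωp : ℂ_[3]) (L' : UnrSeries 3), ΩK ≠ 0 → Ωp ≠ 0 →
        IsBDPLFunction ι' 𝔭 κ γ Dt'.f ΩK Ωp L' →
        (AcSelmer.XAc.charIdeal (W'.baseChange K) 3 κ 𝔭' ∅ γ).map (PowerSeries.map (toUnr 3)) =
          Ideal.span {L'}) := by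
  have hd3 : NumberField.discr K ≠ -3 := discr_ne_neg_three_of_degreeOne hK h𝔭 he hf
  obtain ⟨ΩK₃, Ωp₃, L₃, hΩK₃, hL₃, hμ⟩ := exists_frame_mu_eq_zero_of_good h422 W' N' K Dt' hgood hsurj
    hK hH hodd hd3 κ hκ γ 𝔭 h𝔭 he hf ι' hι'
  have hΩp₃ : ((Ωp₃ : unrIntegers 3) : ℂ_[3]) ≠ 0 := by
    intro h0
    have h1 := norm_coe_units_unrIntegers 3 Ωp₃
    rw [h0, norm_zero] at h1
    exact zero_ne_one h1
  exact twinSplit_instance_of_three_frames W' N' K Dt' κ γ 𝔭 𝔭' ι' hK hκ hHow hWan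
    ⟨ΩK₃, _, L₃, hΩK₃, hΩp₃, hL₃, hμ⟩

end Crux

end Summit.BirchSwinnertonDyer.BirchSwinnertonDyer.Theorems.UniversalToricDescentTwinSplit

end
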